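import Summits.Parity.GeneralizedHardyLittlewood.Theses.PrimeLevelFamEdge
import Summits.Parity.GeneralizedHardyLittlewood.Theorems.BeyondDiagonalBeatsQuarter.UpperSomewhereBand
import Literature.NumberTheory.LFunctions.KMVSignedSecondGap
import Literature.NumberTheory.LFunctions.KMVAmplifiedDiagonalForms
import Literature.NumberTheory.LFunctions.KMVMomentAsymptoticsUniqueness
import Literature.NumberTheory.LFunctions.KMVSecondMainTermFloorMasses
import Literature.NumberTheory.LFunctions.KMVMollifierDiagonalMainTerm
import Literature.NumberTheory.LFunctions.IwaniecSarnakFamilyWeightTwoPeterssonPB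
import HarnessLib

/-!
# Route `PrimeLevelFamEdge`, crux K_B `BeyondDiagonalBeatsQuarter` (stmt-Parity-20343), line
# `diagonal_kernel_split` rev 2: the RESHAPE glue R0–R2 — a pointwise, infinitely-often, fixed-tolerance
# kernel-excess control (the registered heart H⁻_io,U `stub_kernelExcessBelowSlack_io`) closes K_B

STUB-PLAN `Cruxes/BeyondDiagonalBeatsQuarter/STUB-PLAN-stub_kernelDiagonalUpperOnPrimeAverageXSq.md`
Decision 1 (= k=2 STUB-IDEAS-2 Plan 2) replaces the rev-1 heart H⁻ of the line (signed average over the good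
primes of every late dyadic block, `∀ ε > 0 ∃ N₀ ∀ N ≥ N₀`) by the weakest shape the composition accepts:
for `Δ′` in a window `(1, b)` a FIXED tolerance `U < 4(Δ′−1)/Δ′` (the band slack of
`upperSomewhere_X_sq_iff_T₂_band`) such that beyond every threshold there is a good prime `q`
(`q̂^{Δ′} ∉ ℕ`) with `re Q^h(X²,1;q̂^{Δ′}) − 2q̂·Σ_{m₁,m₂} x x·kmvKernel(log q̂) ≤ U·mainScaleReal Δ′ q`
(`x_m = μ(m)ψ(m)⁻¹(log(M/m)/log M)²`, `M = q̂^{Δ′}`). This file is the Theorems-side copy of the skeleton's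
composition (the `Cruxes/…/Lines` module is a workfile, not importable), so that the stub's eventual proof
closes the crux by a two-line file:
* `kernelExcess_io_of_blockAverage` (R0) — the rev-1 heart implies the new one (`U = 2(Δ′−1)/Δ′`; an
  average `≤ U·Σms` over a non-empty block has a term `≤ U·ms_q`): the reshape loses nothing provable;
* `T₂_le_of_secondMomentUpperControl_io` (R1) — i.o. twin of
  `OffDiagonalUpperControl.T₂_le_of_secondMomentUpperControl` (p-landed, :205): `T₂` is level-free, so an
  upper control at ONE good prime beyond each threshold pins `T₂ ≤ U` (same proof, the i.o. hypothesis
  supplying the prime; no `GoodPrimesUnbounded`);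
* `kernelMainTerm_eventually`, `T₂_le_of_kernelExcess_io` — with the q-free kernel asymptotics of stub N
  (`stub_kernelFormXSq`, p602508) the kernel-currency control gives `T₂(Δ′,X²,1) ≤ U`;
* `upperSomewhere_X_sq_of_kernelExcess_io` (R2a) — hence the T₂-band on `(1, min b Δ 2)`, i.e. S2u;
* `beyondDiagonalBeatsQuarter_of_kernelExcess_io` (R2) — Pt′ (`kowalskiMichel2000_peterssonBound`) + N + H⁻_io,U
  ⇒ K_B BY NAME (the S2u ⇒ K_B step is the argument of `beyondDiagonalBeatsQuarter_of_upperSomewhere_X_sq'`,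
  p532279, repeated inline at `P = X²` so that this file imports the route file directly and no other module of
  its cone — theses-cone lint: Cauchy–Schwarz floor `4 ≤ second + T₂` from the two harmonic-mass roots over the
  repaired Petersson bound, `T₁ = 0` from the crux's Bettin antecedent).
The heart itself (famE-02-class, FRONTIER; plan Ω behind paper gates G1/G2) is DISPLAYED as a hypothesis, never
asserted; no Theses statement is asserted; standard axioms. «The programme SEARCHES and TYPES; no claim about
Landau–Siegel zeros, Theorems 1–2 of arXiv:2211.02515 or a repaired Margin232 until a kernel theorem says so.»
-/

noncomputable section

open Finset Polynomial
open scoped Real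

namespace Summit.Parity.GeneralizedHardyLittlewood.Theorems.BeyondDiagonalBeatsQuarter

open Literature.NumberTheory.LFunctions
open Literature.NumberTheory.LFunctions.KMV2000
open Summit.Parity.GeneralizedHardyLittlewood.Theses.PrimeLevelFamEdge

/-- **R0 (the reshape is a weakening).** The rev-1 heart H⁻ (signed block average, `∀ ε ∀ N ≥ N₀`,
verbatim :93–108 of rev 1) implies H⁻_io,U with `U = 2(Δ′−1)/Δ′` (half the slack): an average `≤ U·Σms`
over a non-empty block has a term `≤ U·ms_q`, and blocks holding good primes recur
(`KMV2000.exists_goodPrimes_nonempty`, `goodPrimesUnbounded_of_lt_two`). So nothing provable is lost. -/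
theorem kernelExcess_io_of_blockAverage
    (hH : ∃ b : ℝ, 1 < b ∧ ∀ Δ' : ℝ, 1 < Δ' → Δ' < b → ∀ ε : ℝ, 0 < ε → ∃ N₀ : ℕ, ∀ N : ℕ, N₀ ≤ N →
      (∑ q ∈ KMV2000.goodPrimes Δ' N,
          ((if hq : q = 0 then (0 : ℂ) else
              (haveI : NeZero q := ⟨hq⟩; KMV2000.QhPQ q (X ^ 2) 1 (KMV2000.qhat q ^ Δ'))) -
            ((2 * KMV2000.qhat q *
                ∑ m₁ ∈ Icc 1 ⌊KMV2000.qhat q ^ Δ'⌋₊, ∑ m₂ ∈ Icc 1 ⌊KMV2000.qhat q ^ Δ'⌋₊,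
                  ((ArithmeticFunction.moebius m₁ : ℝ) *
                      ((KMV2000.psi m₁)⁻¹ * (X ^ 2 : ℝ[X]).eval
                        (Real.log (KMV2000.qhat q ^ Δ' / m₁) / Real.log (KMV2000.qhat q ^ Δ')))) *
                    ((ArithmeticFunction.moebius m₂ : ℝ) *
                      ((KMV2000.psi m₂)⁻¹ * (X ^ 2 : ℝ[X]).eval
                        (Real.log (KMV2000.qhat q ^ Δ' / m₂) / Real.log (KMV2000.qhat q ^ Δ')))) *
                    KMV2000.kmvKernel (Real.log (KMV2000.qhat q)) m₁ m₂ : ℝ) : ℂ))).re ≤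
        ε * ∑ q ∈ KMV2000.goodPrimes Δ' N, KMV2000.mainScaleReal Δ' q) :
    ∃ b : ℝ, 1 < b ∧ ∀ Δ' : ℝ, 1 < Δ' → Δ' < b → ∃ U : ℝ, U < 4 * (Δ' - 1) / Δ' ∧
      ∀ q₀ : ℕ, ∃ q : ℕ, ∃ _ : NeZero q, q₀ ≤ q ∧ q.Prime ∧
        (∀ n : ℕ, (n : ℝ) ≠ KMV2000.qhat q ^ Δ') ∧
          (KMV2000.QhPQ q (X ^ 2) 1 (KMV2000.qhat q ^ Δ')).re -
              2 * KMV2000.qhat q *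
                ∑ m₁ ∈ Icc 1 ⌊KMV2000.qhat q ^ Δ'⌋₊, ∑ m₂ ∈ Icc 1 ⌊KMV2000.qhat q ^ Δ'⌋₊,
                  ((ArithmeticFunction.moebius m₁ : ℝ) *
                      ((KMV2000.psi m₁)⁻¹ * (X ^ 2 : ℝ[X]).eval
                        (Real.log (KMV2000.qhat q ^ Δ' / m₁) / Real.log (KMV2000.qhat q ^ Δ')))) *
                    ((ArithmeticFunction.moebius m₂ : ℝ) *
                      ((KMV2000.psi m₂)⁻¹ * (X ^ 2 : ℝ[X]).eval
                        (Real.log (KMV2000.qhat q ^ Δ' / m₂) / Real.log (KMV2000.qhat q ^ Δ')))) *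
                    KMV2000.kmvKernel (Real.log (KMV2000.qhat q)) m₁ m₂ ≤
            U * KMV2000.mainScaleReal Δ' q := by
  obtain ⟨b, hb, hH⟩ := hH
  refine ⟨min b 2, lt_min hb (by norm_num), fun Δ' h1 h2 ↦ ?_⟩
  have hΔ'b : Δ' < b := lt_of_lt_of_le h2 (min_le_left _ _)
  have hΔ'2 : Δ' < 2 := lt_of_lt_of_le h2 (min_le_right _ _)
  have hΔ'0 : 0 < Δ' := by linarith
  set U : ℝ := 2 * (Δ' - 1) / Δ' with hU_def
  have hUpos : 0 < U := by rw [hU_def]; exact div_pos (by linarith) hΔ'0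
  have hUslack : U < 4 * (Δ' - 1) / Δ' := by
    rw [hU_def]; exact div_lt_div_of_pos_right (by linarith) hΔ'0
  refine ⟨U, hUslack, fun q₀ ↦ ?_⟩
  obtain ⟨N₀, hN₀⟩ := hH Δ' h1 hΔ'b U hUpos
  obtain ⟨N, hNge, hNne⟩ :=
    KMV2000.exists_goodPrimes_nonempty (KMV2000.goodPrimesUnbounded_of_lt_two hΔ'0 hΔ'2) (max N₀ q₀)
  have hblock := hN₀ N (le_trans (le_max_left _ _) hNge)
  rw [Complex.re_sum, Finset.mul_sum] at hblock
  obtain ⟨q, hqmem, hqle⟩ := Finset.exists_le_of_sum_le hNne hblock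
  obtain ⟨hqN, -, hqp, hqg⟩ := KMV2000.mem_goodPrimes_iff.mp hqmem
  haveI : NeZero q := ⟨hqp.ne_zero⟩
  refine ⟨q, inferInstance, ?_, hqp, fun n ↦ by simpa [KMV2000.qhat] using hqg n, ?_⟩
  · have := le_trans (le_max_right _ _) hNge
    omega
  · rw [dif_neg hqp.ne_zero] at hqle
    simpa only [Complex.sub_re, Complex.ofReal_re] using hqle

/-- **R1 (i.o. twin of `OffDiagonalUpperControl.T₂_le_of_secondMomentUpperControl`).** If the KMV moment
asymptotics hold on a window with extra main terms `(T₁, T₂)` and, at an admissible `P`, an even-or-odd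
`Q` and a length `Δ' ∈ (Δlo, Δhi]`, `Δ' > 0`, the upper control
`re Q^h(P,Q; q̂^{Δ'}) ≤ 2ζ(2)² q̂/(Δ'² log² q̂)·(second(Δ',P,Q) + U) + C q̂ log⁻³ q̂` holds at good primes
beyond every threshold (INFINITELY OFTEN — the i.o. hypothesis supplies the prime; no
`GoodPrimesUnbounded` needed), then `T₂ Δ' P Q ≤ U`: `T₂` is level-free, so ONE good prime beyond
`max q₀ N` decides it. Proof = the tree's :205 proof with `hctl` supplying the prime.
[cite: KowalskiMichelVanderKam2000, §6 p. 19 (shape of the second-moment display), §2 p. 7 (M ∉ ℤ)] -/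
theorem T₂_le_of_secondMomentUpperControl_io {Δlo Δhi : ℝ} {T₁ T₂ : ℝ → ℝ[X] → ℝ[X] → ℝ}
    (hMA : MomentAsymptotics Δlo Δhi T₁ T₂) {P Q : ℝ[X]} (hP : Admissible P)
    (hQ : IsEvenOrOdd Q) {Δ' : ℝ} (h1 : Δlo < Δ') (h2 : Δ' ≤ Δhi) (hΔ' : 0 < Δ') {U C : ℝ}
    (hctl : ∀ q₁ : ℕ, ∃ q : ℕ, ∃ _ : NeZero q, q₁ ≤ q ∧ q.Prime ∧
      (∀ n : ℕ, (n : ℝ) ≠ qhat q ^ Δ') ∧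
        (QhPQ q P Q (qhat q ^ Δ')).re ≤
          2 * (π ^ 2 / 6) ^ 2 * (qhat q / (Δ' ^ 2 * Real.log (qhat q) ^ 2)) *
              (secondMomentForm Δ' P Q + U) +
            C * qhat q * (Real.log (qhat q))⁻¹ ^ 3) :
    T₂ Δ' P Q ≤ U := by
  by_contra hle
  have hlt : U < T₂ Δ' P Q := lt_of_not_ge hle
  obtain ⟨C₂, q₀, H⟩ := hMA P Q hP hQ Δ' h1 h2
  set δ : ℝ := T₂ Δ' P Q - U with hδ
  have hδpos : 0 < δ := by rw [hδ]; linarith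
  set z : ℝ := 2 * (π ^ 2 / 6) ^ 2 with hz
  have hzpos : 0 < z := by rw [hz]; positivity
  have hZ : (2 * riemannZeta 2 ^ 2 : ℂ) = ((z : ℝ) : ℂ) := by
    rw [riemannZeta_two, hz]; push_cast; ring
  set B : ℝ := (|C| + |C₂|) * Δ' ^ 2 / (z * δ) + 1 with hB
  obtain ⟨N, hN⟩ := exists_log_qhat_ge B
  obtain ⟨q, inst, hqge, hq, hgoodq, b0⟩ := hctl (max q₀ N)
  have hq0 : q₀ ≤ q := le_trans (le_max_left _ _) hqge
  have hqN : N ≤ q := le_trans (le_max_right _ _) hqge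
  have hlg : B ≤ Real.log (qhat q) := hN q hqN
  have hB1 : 1 ≤ B := by
    have : 0 ≤ (|C| + |C₂|) * Δ' ^ 2 / (z * δ) := by positivity
    rw [hB]; linarith
  have hlgpos : 0 < Real.log (qhat q) := by linarith
  have hqhatpos : 0 < qhat q := by
    unfold qhat
    have : 0 < (q : ℝ) := by exact_mod_cast hq.pos
    positivity
  obtain ⟨-, b1⟩ := H q hq hq0 hgoodq
  set R : ℝ := (QhPQ q P Q (qhat q ^ Δ')).re with hR
  set r : ℝ := qhat q / (Δ' ^ 2 * Real.log (qhat q) ^ 2) with hr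
  have hrpos : 0 < r := by rw [hr]; positivity
  have hs3 : 0 ≤ qhat q * (Real.log (qhat q))⁻¹ ^ 3 := by positivity
  -- MA: |R − z r (second + T₂)| ≤ |C₂| q̂ log⁻³
  have hb1 : z * r * (secondMomentForm Δ' P Q + T₂ Δ' P Q) -
      |C₂| * qhat q * (Real.log (qhat q))⁻¹ ^ 3 ≤ R := by
    have e : (2 * riemannZeta 2 ^ 2 * ((r : ℝ) : ℂ)) *
        ((secondMomentForm Δ' P Q + T₂ Δ' P Q : ℝ) : ℂ) =
        ((z * r * (secondMomentForm Δ' P Q + T₂ Δ' P Q) : ℝ) : ℂ) := by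
      rw [hZ]; push_cast; ring
    rw [e] at b1
    have h' := (Complex.abs_re_le_norm _).trans b1
    rw [Complex.sub_re, Complex.ofReal_re, ← hR] at h'
    have hC : C₂ * qhat q * (Real.log (qhat q))⁻¹ ^ 3 ≤ |C₂| * qhat q * (Real.log (qhat q))⁻¹ ^ 3 := by
      rw [mul_assoc, mul_assoc]
      exact mul_le_mul_of_nonneg_right (le_abs_self C₂) hs3
    have := (abs_le.1 (h'.trans hC)).1
    linarith
  -- control: R ≤ z r (second + U) + |C| q̂ log⁻³
  have hb0 : R ≤ z * r * (secondMomentForm Δ' P Q + U) + |C| * qhat q * (Real.log (qhat q))⁻¹ ^ 3 := by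
    have hC : C * qhat q * (Real.log (qhat q))⁻¹ ^ 3 ≤ |C| * qhat q * (Real.log (qhat q))⁻¹ ^ 3 := by
      rw [mul_assoc, mul_assoc]
      exact mul_le_mul_of_nonneg_right (le_abs_self C) hs3
    linarith [b0, hC]
  have key : z * r * δ ≤ (|C| + |C₂|) * qhat q * (Real.log (qhat q))⁻¹ ^ 3 := by
    have e : z * r * δ = z * r * (secondMomentForm Δ' P Q + T₂ Δ' P Q) -
        z * r * (secondMomentForm Δ' P Q + U) := by rw [hδ]; ring
    rw [e]; linarith
  have key2 : z * δ * Real.log (qhat q) ≤ (|C| + |C₂|) * Δ' ^ 2 := by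
    rw [hr] at key
    have e1 : z * (qhat q / (Δ' ^ 2 * Real.log (qhat q) ^ 2)) * δ =
        (z * δ * Real.log (qhat q)) * (qhat q / (Δ' ^ 2 * Real.log (qhat q) ^ 3)) := by
      field_simp
    have e2 : (|C| + |C₂|) * qhat q * (Real.log (qhat q))⁻¹ ^ 3 =
        ((|C| + |C₂|) * Δ' ^ 2) * (qhat q / (Δ' ^ 2 * Real.log (qhat q) ^ 3)) := by
      field_simp
    rw [e1, e2] at key
    have hw : 0 < qhat q / (Δ' ^ 2 * Real.log (qhat q) ^ 3) := by positivity
    exact le_of_mul_le_mul_right key hw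
  have hzd : 0 < z * δ := mul_pos hzpos hδpos
  have key3 : z * δ * B ≤ (|C| + |C₂|) * Δ' ^ 2 :=
    le_trans (mul_le_mul_of_nonneg_left hlg hzd.le) key2
  rw [hB] at key3
  have e3 : z * δ * ((|C| + |C₂|) * Δ' ^ 2 / (z * δ) + 1) = (|C| + |C₂|) * Δ' ^ 2 + z * δ := by
    field_simp
  rw [e3] at key3
  linarith

/-- Specialisation of q-free kernel asymptotics `KF(M, L) = 4ζ(2)²(L/log M + 1)/log²M + O(log⁻³M)` to
`M = q̂^{Δ′}`, `L = log q̂`, `Δ′ ≥ 1`: `|2q̂·KF − mainScaleReal·secondMomentForm(Δ′,X²,1)| ≤ δ·mainScaleReal`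
for `q ≥ q₀(Δ′,δ)` (stated for an abstract kernel form `KF`; used with the `X²` double sum of stub N). -/
theorem kernelMainTerm_eventually {KF : ℝ → ℝ → ℝ} {C M₀ : ℝ}
    (hN : ∀ M : ℝ, M₀ ≤ M → ∀ L : ℝ, 0 ≤ L → L ≤ Real.log M →
      |KF M L - 4 * (π ^ 2 / 6) ^ 2 * (L / Real.log M + 1) / Real.log M ^ 2| ≤ C / Real.log M ^ 3)
    {Δ' : ℝ} (h1 : 1 ≤ Δ') {δ : ℝ} (hδ : 0 < δ) :
    ∃ q₀ : ℕ, ∀ q : ℕ, q₀ ≤ q →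
      |2 * qhat q * KF (qhat q ^ Δ') (Real.log (qhat q)) -
          mainScaleReal Δ' q * secondMomentForm Δ' (X ^ 2) 1| ≤ δ * mainScaleReal Δ' q := by
  -- thresholds: q ≥ 40 (so q̂ > 1), q̂ ≥ M₀ (so q̂^{Δ'} ≥ M₀), log q̂ ≥ K := C / (δ (π²/6)² Δ')
  set ζ2 : ℝ := π ^ 2 / 6 with hζ2
  have hζ2pos : 0 < ζ2 := by positivity
  set K : ℝ := C / (δ * ζ2 ^ 2 * Δ') with hK
  set T : ℝ := max (max M₀ 1) (Real.exp K) with hT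
  refine ⟨max 40 ⌈(2 * π * T) ^ 2⌉₊, fun q hq ↦ ?_⟩
  have hq40 : 40 ≤ q := le_of_max_le_left hq
  have hqT : ⌈(2 * π * T) ^ 2⌉₊ ≤ q := le_of_max_le_right hq
  set s : ℝ := qhat q with hs
  have hs1 : 1 < s := one_lt_qhat hq40
  have hs0 : 0 < s := lt_trans one_pos hs1
  have hlog0 : 0 < Real.log s := Real.log_pos hs1
  have hsT : T ≤ s := by
    have hqR : (2 * π * T) ^ 2 ≤ (q : ℝ) := (Nat.le_ceil _).trans (by exact_mod_cast hqT)
    have h2π : 0 < 2 * π := by positivity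
    have hT0 : 0 ≤ T := le_trans zero_le_one ((le_max_right _ _).trans (le_max_left _ _))
    have hsq : 2 * π * T ≤ Real.sqrt q := by
      rw [show (2 * π * T : ℝ) = Real.sqrt ((2 * π * T) ^ 2) by rw [Real.sqrt_sq (by positivity)]]
      exact Real.sqrt_le_sqrt hqR
    rw [hs, qhat, le_div_iff₀ h2π]
    linarith
  have hsM₀ : M₀ ≤ s := le_trans ((le_max_left _ _).trans (le_max_left _ _)) hsT
  have hsK : K ≤ Real.log s := by
    have : Real.exp K ≤ s := (le_max_right _ _).trans hsT
    simpa [Real.log_exp] using Real.log_le_log (Real.exp_pos K) this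
  have hM : Real.log (s ^ Δ') = Δ' * Real.log s := Real.log_rpow hs0 Δ'
  have hsM : s ≤ s ^ Δ' := by
    simpa [Real.rpow_one] using Real.rpow_le_rpow_of_exponent_le hs1.le h1
  have hMM₀ : M₀ ≤ s ^ Δ' := hsM₀.trans hsM
  have hΔ0 : 0 < Δ' := lt_of_lt_of_le one_pos h1
  have hL1 : Real.log s ≤ Real.log (s ^ Δ') := by rw [hM]; nlinarith
  have key := hN (s ^ Δ') hMM₀ (Real.log s) hlog0.le hL1
  rw [hM] at key
  have hms : mainScaleReal Δ' q = 2 * ζ2 ^ 2 * (s / (Δ' ^ 2 * Real.log s ^ 2)) := by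
    simp only [mainScaleReal, hs, qhat, hζ2]
  have hsec : secondMomentForm Δ' (X ^ 2) 1 = 4 + 4 / Δ' := secondMomentForm_X_sq_one Δ'
  have hlogne : Real.log s ≠ 0 := hlog0.ne'
  have hΔne : Δ' ≠ 0 := hΔ0.ne'
  have hmain : 2 * s * (4 * ζ2 ^ 2 * (Real.log s / (Δ' * Real.log s) + 1) / (Δ' * Real.log s) ^ 2) =
      mainScaleReal Δ' q * secondMomentForm Δ' (X ^ 2) 1 := by
    rw [hms, hsec]; field_simp; ring
  have herr : 2 * s * (C / (Δ' * Real.log s) ^ 3) ≤ δ * mainScaleReal Δ' q := by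
    rw [hms]
    have hC : C ≤ δ * ζ2 ^ 2 * Δ' * Real.log s := by
      have hden : 0 < δ * ζ2 ^ 2 * Δ' := by positivity
      have := (div_le_iff₀' hden).mp (hK ▸ hsK : C / (δ * ζ2 ^ 2 * Δ') ≤ Real.log s)
      linarith
    rw [show 2 * s * (C / (Δ' * Real.log s) ^ 3) = C * (2 * s / (Δ' ^ 3 * Real.log s ^ 3)) by
      field_simp]
    rw [show δ * (2 * ζ2 ^ 2 * (s / (Δ' ^ 2 * Real.log s ^ 2))) =
        (δ * ζ2 ^ 2 * Δ' * Real.log s) * (2 * s / (Δ' ^ 3 * Real.log s ^ 3)) by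
      field_simp]
    exact mul_le_mul_of_nonneg_right hC (by positivity)
  have h2s : 0 < 2 * s := by positivity
  calc |2 * s * KF (s ^ Δ') (Real.log s) - mainScaleReal Δ' q * secondMomentForm Δ' (X ^ 2) 1|
      = |2 * s * (KF (s ^ Δ') (Real.log s) -
          4 * ζ2 ^ 2 * (Real.log s / (Δ' * Real.log s) + 1) / (Δ' * Real.log s) ^ 2)| := by
        rw [← hmain]; ring_nf
    _ = 2 * s * |KF (s ^ Δ') (Real.log s) -
          4 * ζ2 ^ 2 * (Real.log s / (Δ' * Real.log s) + 1) / (Δ' * Real.log s) ^ 2| := by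
        rw [abs_mul, abs_of_pos h2s]
    _ ≤ 2 * s * (C / (Δ' * Real.log s) ^ 3) := mul_le_mul_of_nonneg_left key h2s.le
    _ ≤ δ * mainScaleReal Δ' q := herr

/-- **R1 in kernel currency: N + H⁻_io,U at one length pin `T₂ ≤ U`.** Under `MomentAsymptotics` on a
window containing `Δ' ≥ 1`, if a kernel form `KF` has the q-free asymptotics of stub N and
`re Q^h(X²,1;q̂^{Δ'}) − 2q̂·KF(q̂^{Δ'}, log q̂) ≤ U·mainScaleReal` at good primes beyond every threshold,
then `T₂ Δ' X² 1 ≤ U` (for every `δ > 0`, N gives `2q̂·KF ≤ (second + δ)·mainScaleReal` eventually, so R1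
yields `T₂ ≤ U + δ`). [cite: KowalskiMichelVanderKam2000, §6 p. 19; Prop. 5.1 (31)] -/
theorem T₂_le_of_kernelExcess_io {Δlo Δhi : ℝ} {T₁ T₂ : ℝ → ℝ[X] → ℝ[X] → ℝ}
    (hMA : MomentAsymptotics Δlo Δhi T₁ T₂) {Δ' : ℝ} (h1 : Δlo < Δ') (h2 : Δ' ≤ Δhi) (hΔ'1 : 1 ≤ Δ')
    {KF : ℝ → ℝ → ℝ} {C M₀ : ℝ}
    (hN : ∀ M : ℝ, M₀ ≤ M → ∀ L : ℝ, 0 ≤ L → L ≤ Real.log M →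
      |KF M L - 4 * (π ^ 2 / 6) ^ 2 * (L / Real.log M + 1) / Real.log M ^ 2| ≤ C / Real.log M ^ 3)
    {U : ℝ}
    (hio : ∀ q₀ : ℕ, ∃ q : ℕ, ∃ _ : NeZero q, q₀ ≤ q ∧ q.Prime ∧
      (∀ n : ℕ, (n : ℝ) ≠ qhat q ^ Δ') ∧
        (QhPQ q (X ^ 2) 1 (qhat q ^ Δ')).re - 2 * qhat q * KF (qhat q ^ Δ') (Real.log (qhat q)) ≤
          U * mainScaleReal Δ' q) :
    T₂ Δ' (X ^ 2) 1 ≤ U := by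
  have hΔ'0 : 0 < Δ' := lt_of_lt_of_le one_pos hΔ'1
  refine le_of_forall_pos_lt_add fun δ hδ ↦ ?_
  have hδ2 : 0 < δ / 2 := by positivity
  obtain ⟨q₁, hq₁⟩ := kernelMainTerm_eventually hN hΔ'1 hδ2
  have hT : T₂ Δ' (X ^ 2) 1 ≤ U + δ / 2 := by
    refine T₂_le_of_secondMomentUpperControl_io hMA admissible_X_sq isEvenOrOdd_one h1 h2 hΔ'0
      (U := U + δ / 2) (C := 0) fun q₂ ↦ ?_
    obtain ⟨q, inst, hqge, hq, hg, hle⟩ := hio (max q₁ q₂)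
    refine ⟨q, inst, le_trans (le_max_right _ _) hqge, hq, hg, ?_⟩
    have hK := hq₁ q (le_trans (le_max_left _ _) hqge)
    have hms : mainScaleReal Δ' q = 2 * (π ^ 2 / 6) ^ 2 * (qhat q / (Δ' ^ 2 * Real.log (qhat q) ^ 2)) := by
      simp only [mainScaleReal, qhat]
    have hK' := (abs_le.1 hK).2
    rw [← hms]
    nlinarith [mainScaleReal_nonneg Δ' q]
  linarith

/-- **R2 (first half): N + H⁻_io,U ⇒ S2u.** For every window `(1, Δ]` and every MA-consistent `(T₁, T₂)`,
on the sub-window `(1, min b (min Δ 2))` the heart gives `T₂ Δ' X² 1 ≤ U < 4(Δ'−1)/Δ'`, i.e. the T₂-band,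
i.e. `second + T₂ < 2·lin²` at `X²` (`secondMomentForm_X_sq_add_lt_iff`). No Petersson input.
[cite: KowalskiMichelVanderKam2000, Thm. 6.1 (30)–(32), §6 p. 19] -/
theorem upperSomewhere_X_sq_of_kernelExcess_io {KF : ℝ → ℝ → ℝ} {C M₀ : ℝ}
    (hN : ∀ M : ℝ, M₀ ≤ M → ∀ L : ℝ, 0 ≤ L → L ≤ Real.log M →
      |KF M L - 4 * (π ^ 2 / 6) ^ 2 * (L / Real.log M + 1) / Real.log M ^ 2| ≤ C / Real.log M ^ 3)
    (hIO : ∃ b : ℝ, 1 < b ∧ ∀ Δ' : ℝ, 1 < Δ' → Δ' < b → ∃ U : ℝ, U < 4 * (Δ' - 1) / Δ' ∧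
      ∀ q₀ : ℕ, ∃ q : ℕ, ∃ _ : NeZero q, q₀ ≤ q ∧ q.Prime ∧
        (∀ n : ℕ, (n : ℝ) ≠ qhat q ^ Δ') ∧
          (QhPQ q (X ^ 2) 1 (qhat q ^ Δ')).re - 2 * qhat q * KF (qhat q ^ Δ') (Real.log (qhat q)) ≤
            U * mainScaleReal Δ' q) :
    ∀ Δ : ℝ, 1 < Δ → ∀ T₁ T₂ : ℝ → ℝ[X] → ℝ[X] → ℝ, MomentAsymptotics 1 Δ T₁ T₂ →
      ∃ a b : ℝ, 1 ≤ a ∧ a < b ∧ b ≤ min Δ 2 ∧ a < 3 / 2 ∧ ∀ Δ' : ℝ, a < Δ' → Δ' < b →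
        secondMomentForm Δ' (X ^ 2) 1 + T₂ Δ' (X ^ 2) 1 < 2 * linForm Δ' (X ^ 2) 1 ^ 2 := by
  intro Δ hΔ T₁ T₂ hMA
  obtain ⟨b, hb, hwin⟩ := hIO
  refine ⟨1, min b (min Δ 2), le_rfl, lt_min hb (lt_min hΔ (by norm_num)), min_le_right _ _,
    by norm_num, fun Δ' h1' h2' ↦ ?_⟩
  have hΔ'b : Δ' < b := lt_of_lt_of_le h2' (min_le_left _ _)
  have hΔ'Δ : Δ' < Δ := lt_of_lt_of_le h2' ((min_le_right _ _).trans (min_le_left _ _))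
  obtain ⟨U, hU, hio⟩ := hwin Δ' h1' hΔ'b
  have hT₂ : T₂ Δ' (X ^ 2) 1 ≤ U := T₂_le_of_kernelExcess_io hMA h1' hΔ'Δ.le h1'.le hN hio
  exact (secondMomentForm_X_sq_add_lt_iff (by linarith) _).2 (lt_of_le_of_lt hT₂ hU)

/-- **R2: Pt′ + N + H⁻_io,U ⇒ K_B, by name.** The in-range Petersson bound at prime level
(`KowalskiMichel2000.kowalskiMichel2000_peterssonBound`, the route support `PeterssonBoundPrinted`), the
q-free `X²` kernel asymptotics (stub N, landed as `PrimeLevelFamEdge.stub_kernelFormXSq`, p602508) and the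
reshaped heart H⁻_io,U (registered stub `stub_kernelExcessBelowSlack_io` of `Lines/diagonal_kernel_split.lean`
rev 2, verbatim below as the hypothesis `hIO`) give `PrimeLevelFamEdge.BeyondDiagonalBeatsQuarter`: S2u by
`upperSomewhere_X_sq_of_kernelExcess_io`, then `beyondDiagonalBeatsQuarter_of_upperSomewhere_X_sq'`
(Cauchy–Schwarz floor from the Petersson bound, `T₁ = 0` from the crux's Bettin antecedent).
[cite: KowalskiMichelVanderKam2000, Thm. 6.1 (30)–(32), (21)–(23), §6 p. 19]
[cite: KowalskiMichel2000, §2.3 p. 310 (display after (16)) and §2.4.2 (23)] -/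
theorem beyondDiagonalBeatsQuarter_of_kernelExcess_io
    (hPB : KowalskiMichel2000.kowalskiMichel2000_peterssonBound)
    (hN : ∃ C M₀ : ℝ, ∀ M : ℝ, M₀ ≤ M → ∀ L : ℝ, 0 ≤ L → L ≤ Real.log M →
      |(∑ m₁ ∈ Icc 1 ⌊M⌋₊, ∑ m₂ ∈ Icc 1 ⌊M⌋₊,
          ((ArithmeticFunction.moebius m₁ : ℝ) *
              ((KMV2000.psi m₁)⁻¹ * (X ^ 2 : ℝ[X]).eval (Real.log (M / m₁) / Real.log M))) *
            ((ArithmeticFunction.moebius m₂ : ℝ) *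
              ((KMV2000.psi m₂)⁻¹ * (X ^ 2 : ℝ[X]).eval (Real.log (M / m₂) / Real.log M))) *
            KMV2000.kmvKernel L m₁ m₂) -
        4 * (π ^ 2 / 6) ^ 2 * (L / Real.log M + 1) / Real.log M ^ 2| ≤ C / Real.log M ^ 3)
    (hIO : ∃ b : ℝ, 1 < b ∧ ∀ Δ' : ℝ, 1 < Δ' → Δ' < b → ∃ U : ℝ, U < 4 * (Δ' - 1) / Δ' ∧
      ∀ q₀ : ℕ, ∃ q : ℕ, ∃ _ : NeZero q, q₀ ≤ q ∧ q.Prime ∧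
        (∀ n : ℕ, (n : ℝ) ≠ KMV2000.qhat q ^ Δ') ∧
          (KMV2000.QhPQ q (X ^ 2) 1 (KMV2000.qhat q ^ Δ')).re -
              2 * KMV2000.qhat q *
                ∑ m₁ ∈ Icc 1 ⌊KMV2000.qhat q ^ Δ'⌋₊, ∑ m₂ ∈ Icc 1 ⌊KMV2000.qhat q ^ Δ'⌋₊,
                  ((ArithmeticFunction.moebius m₁ : ℝ) *
                      ((KMV2000.psi m₁)⁻¹ * (X ^ 2 : ℝ[X]).eval
                        (Real.log (KMV2000.qhat q ^ Δ' / m₁) / Real.log (KMV2000.qhat q ^ Δ')))) *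
                    ((ArithmeticFunction.moebius m₂ : ℝ) *
                      ((KMV2000.psi m₂)⁻¹ * (X ^ 2 : ℝ[X]).eval
                        (Real.log (KMV2000.qhat q ^ Δ' / m₂) / Real.log (KMV2000.qhat q ^ Δ')))) *
                    KMV2000.kmvKernel (Real.log (KMV2000.qhat q)) m₁ m₂ ≤
            U * KMV2000.mainScaleReal Δ' q) :
    BeyondDiagonalBeatsQuarter := by
  obtain ⟨C, M₀, hN⟩ := hN
  have hS := upperSomewhere_X_sq_of_kernelExcess_io (C := C) (M₀ := M₀)
    (KF := fun M L ↦ ∑ m₁ ∈ Icc 1 ⌊M⌋₊, ∑ m₂ ∈ Icc 1 ⌊M⌋₊,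
        ((ArithmeticFunction.moebius m₁ : ℝ) *
            ((KMV2000.psi m₁)⁻¹ * (X ^ 2 : ℝ[X]).eval (Real.log (M / m₁) / Real.log M))) *
          ((ArithmeticFunction.moebius m₂ : ℝ) *
            ((KMV2000.psi m₂)⁻¹ * (X ^ 2 : ℝ[X]).eval (Real.log (M / m₂) / Real.log M))) *
          KMV2000.kmvKernel L m₁ m₂) hN hIO
  -- S2u ⇒ K_B at `P = X²` (the argument of `beyondDiagonalBeatsQuarter_of_upperSomewhere_X_sq'`, p532279)
  intro hF Δ hΔ T₁ T₂ hMA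
  obtain ⟨a, b, ha, hab, hb, ha32, hval⟩ := hS Δ hΔ T₁ T₂ hMA
  refine ⟨a, b, ha, hab, hb.trans (min_le_left _ _), ha32, X ^ 2, admissible_X_sq, fun Δ' h1' h2' ↦ ?_⟩
  have h1 : 1 < Δ' := lt_of_le_of_lt ha h1'
  have hΔ'm : Δ' < min Δ 2 := lt_of_lt_of_le h2' hb
  have hΔ'Δ : Δ' ≤ Δ := (lt_of_lt_of_le hΔ'm (min_le_left _ _)).le
  have hΔ'2 : Δ' < 2 := lt_of_lt_of_le hΔ'm (min_le_right _ _)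
  have hT₁ : T₁ Δ' (X ^ 2) 1 = 0 := T₁_apply_one_eq_zero_of_bettin hF admissible_X_sq hMA h1 hΔ'm
  obtain ⟨Ct, Ht⟩ := CentralValueFamilyHalfEdge.abs_totalMass_sub_one_le_pb hPB
  obtain ⟨Ce, He⟩ := CentralValueFamilyHalfEdge.abs_two_mul_evenMass_sub_totalMass_le_pb hPB
  have hfloor := sq_firstMainTerm_le_secondMainTerm_of_lt_two_of_masses
    ⟨Ct, 3 / 2, by norm_num, fun q _ hq ↦ Ht q hq⟩ ⟨Ce, 1 / 4, by norm_num, fun q _ hq ↦ He q hq⟩ hMA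
    admissible_X_sq (by linarith) hΔ'2 h1 hΔ'Δ
  have hv := hval Δ' h1' h2'
  rw [hT₁, add_zero, linForm_X_sq_one] at hfloor ⊢
  rw [linForm_X_sq_one] at hv
  have hDpos : 0 < secondMomentForm Δ' (X ^ 2) 1 + T₂ Δ' (X ^ 2) 1 := by nlinarith
  rw [lt_div_iff₀ (by positivity)]
  linarith

end Summit.Parity.GeneralizedHardyLittlewood.Theorems.BeyondDiagonalBeatsQuarter
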